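import Literature.NumberTheory.Automorphic.ArithmeticQuotientTransfer
import Mathlib.RepresentationTheory.Homological.GroupCohomology.LongExactSequence
import HarnessLib

/-!
# Exact-sequence lemmas for the finite-level control of ordinary cohomology

Topic `NumberTheory/Automorphic`; namespace `Literature.NumberTheory.Automorphic`, grouping
sub-namespace `LevelControl`; theorems only (Mathlib's `groupCohomology`, its long exact sequence
`groupCohomology.δ`, `mapShortComplex₁/₂/₃_exact`, `δ_naturality`, and the additivity of
`H^n(Γ, -)` in the morphism, `ArithmeticQuotient.map_id_sum`).  Universe `0` (as the level /
transfer files these lemmas serve).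

These are the four pieces of diagram chasing behind the EXACT control of the ordinary parts of
the cohomology of the Hida tower of `GL₂` over an imaginary quadratic field at finite level
(degree `1`: restriction is an isomorphism onto the diamond invariants; top degree `2`: transfer
is an isomorphism from the diamond coinvariants), in the form in which they are consumed — for an
abstract short exact sequence of representations `0 → X₁ → X₂ → X₃ → 0` of a group `Γ`
(in the application `Γ = GL₂(F)`, `X₂ = A` the sections at the small level, `X₁ = A^Δ̄` the
sections at the big level, `Δ̄` the finite torus quotient acting by diamonds):

* `LevelControl.pow_map_apply_eq_zero_of_map_f_eq_zero` — **the kernel of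
  `res : Hʲ(X₁) → Hʲ(X₂)` is killed by `Uᵐ` whenever `Uᵐ` kills `Hⁱ(X₃)`** (`i + 1 = j`, `U` an
  endomorphism of the short exact sequence): `ker res = ∂ Hⁱ(X₃)` and `∂` is `U`-equivariant
  (`δ_naturality`).  With `U = U_p` nilpotent on `H⁰` this is the injectivity of `res` on the
  ordinary part of `H¹` ([Hida1993Duke, §5], inflation–restriction; [KhareThorne2017, §6.3]).
* `LevelControl.exists_map_g_eq_δ` — **invariant classes map into `∂' H^i(C)`**: for a second
  short exact sequence `0 → X₃ →m→ B → C → 0` and endomorphisms `d_t` of `X₂` factoring as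
  `X₂ ↠ X₃ →m→ B →π_t→ X₂` with the `π_t` jointly injective on `Hʲ(B)`, every `ξ ∈ Hʲ(X₂)`
  killed by all `d_t` (the `Δ̄`-invariants, `d_t = δ_t − 1`) has image in `Hʲ(X₃)` of the form
  `∂' c`, `c ∈ Hⁱ(C)` — so that `coker(res : Hʲ(X₁) → Hʲ(X₂)^Δ̄)` is a subquotient of `Hⁱ(C)`,
  killed on ordinary parts when `U_p` is nilpotent on `H⁰(C)`; `pow_map_apply_mem_range_of_forall`
  records this consequence.
* `LevelControl.map_g_surjective_of_subsingleton` — **`Hʲ(X₂) → Hʲ(X₃)` is surjective when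
  `Hʲ⁺¹(X₁) = 0`** (top-degree surjectivity of the transfer `Nm_*`).
* `LevelControl.exists_eq_sum_map_of_map_g_eq_zero` — **the kernel of `Hʲ(X₂) → Hʲ(X₃)` is
  `∑_t e_t Hʲ(X₂)`** when `X₁` is presented as `B' ↠ X₁` with kernel `K'`, `Hʲ⁺¹(K') = 0`,
  `Hʲ(B')` generated by the images of maps `ι_t : X₂ → B'`, and `ι_t ≫ (B' ↠ X₁ ↪ X₂) = e_t`
  (top degree: `ker(tr) = I_Δ̄ · H²`, `e_t = δ_t − 1`).

## References

* H. Hida, *p-ordinary cohomology groups for SL(2) over number fields*, Duke Math. J. 69 (1993),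
  §5 (control via inflation–restriction in degree `r₁ + r₂`). [Hida1993Duke]
* C. Khare, J. A. Thorne, Amer. J. Math. 139 (2017), §6.3 (exact control at finite level,
  Lemma 6.9, Prop. 6.6). [KhareThorne2017]
* K. S. Brown, GTM 87 (1982), III.6 Prop. 6.1 (long exact sequence). [Brown1982CohomologyGroups]
-/

noncomputable section

open CategoryTheory groupCohomology

namespace Literature.NumberTheory.Automorphic

namespace LevelControl

variable {k : Type} [CommRing k] {Γ : Type} [Group Γ]

/-! ### Iterating a commutation relation -/

/-- Pointwise form of Mathlib's `Module.End.commute_pow_left_of_commute` (`a ∘ d = d ∘ b`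
implies `aᵐ ∘ d = d ∘ bᵐ`): if `a (d x) = d (b x)` for all `x` then `aᵐ (d x) = d (bᵐ x)`.
[folklore] -/
theorem pow_apply_comp_eq {M N : Type*} [AddCommGroup M] [AddCommGroup N] [Module k M]
    [Module k N] (a : Module.End k N) (b : Module.End k M) (d : M →ₗ[k] N)
    (h : ∀ x, a (d x) = d (b x)) (m : ℕ) (x : M) : (a ^ m) (d x) = d ((b ^ m) x) :=
  LinearMap.congr_fun
    (Module.End.commute_pow_left_of_commute (LinearMap.ext h : a ∘ₗ d = d ∘ₗ b) m) x

/-! ### Degree-shifting control of the kernel of restriction -/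

/-- **`ker(Hʲ(X₁) → Hʲ(X₂))` is killed by `Uᵐ` if `Uᵐ` kills `Hⁱ(X₃)`** (`i + 1 = j`): for a short
exact sequence `0 → X₁ → X₂ → X₃ → 0` of representations and an endomorphism `F` of it, a class
`x ∈ Hʲ(X₁)` restricting to `0` in `Hʲ(X₂)` is `∂ y` (long exact sequence), and
`F₁ʲ ∘ ∂ = ∂ ∘ F₃ⁱ` (`δ_naturality`), so `(F₁ʲ)ᵐ x = ∂ ((F₃ⁱ)ᵐ y) = 0`.
[cite: Brown1982CohomologyGroups, III.6 Prop. 6.1] [cite: KhareThorne2017, §6.3] -/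
theorem pow_map_apply_eq_zero_of_map_f_eq_zero {X : ShortComplex (Rep k Γ)} (hX : X.ShortExact)
    (F : X ⟶ X) {i j : ℕ} (hij : i + 1 = j) {m : ℕ}
    (h₃ : ∀ y : groupCohomology X.X₃ i, ((map (MonoidHom.id Γ) F.τ₃ i).hom ^ m) y = 0)
    (x : groupCohomology X.X₁ j) (hx : (map (MonoidHom.id Γ) X.f j).hom x = 0) :
    ((map (MonoidHom.id Γ) F.τ₁ j).hom ^ m) x = 0 := by
  have hex := (ShortComplex.moduleCat_exact_iff _).1 (mapShortComplex₁_exact hX hij)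
  obtain ⟨y, hy⟩ := hex x hx
  have hy' : (δ hX i j hij).hom y = x := hy
  have hnat : ∀ z, (map (MonoidHom.id Γ) F.τ₁ j).hom ((δ hX i j hij).hom z) =
      (δ hX i j hij).hom ((map (MonoidHom.id Γ) F.τ₃ i).hom z) := fun z => by
    have h := δ_naturality hX hX F i j hij
    have h' := congrArg (fun φ => (ModuleCat.Hom.hom φ) z) h
    simpa only [ModuleCat.hom_comp, LinearMap.comp_apply] using h'
  rw [← hy', pow_apply_comp_eq _ _ _ hnat m y, h₃ y, map_zero]

/-! ### The cokernel of restriction into the invariants -/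

/-- **Invariant classes of `Hʲ(X₂)` map into `∂' Hⁱ(C)`.**  Let `0 → X₁ → X₂ →g→ X₃ → 0` and
`0 → X₃ →m→ B →q→ C → 0` be short exact, `d_t` (`t ∈ s`) endomorphisms of `X₂` with
`g ≫ m ≫ π_t = d_t` for morphisms `π_t : B → X₂` which are jointly injective on `Hʲ(B)`.  Then for
`ξ ∈ Hʲ(X₂)` with `d_t ξ = 0` for all `t`: `m_*(g_* ξ)` has all projections `π_t` zero, hence is
`0`, hence `g_* ξ = ∂' c` for some `c ∈ Hⁱ(C)` (`i + 1 = j`).  (For `X₁ = A^Δ̄ ≤ X₂ = A`,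
`d_t = δ_t − 1`, `B = ⊕_t A`, this bounds `Hʲ(A)^Δ̄ / res Hʲ(A^Δ̄)` by `Hⁱ(C)`.)
[cite: KhareThorne2017, §6.3] [cite: Hida1993Duke, §5] -/
theorem exists_map_g_eq_δ {X : ShortComplex (Rep k Γ)} {B C : Rep k Γ} (m : X.X₃ ⟶ B)
    (q : B ⟶ C) (w : m ≫ q = 0) (hY : (ShortComplex.mk m q w).ShortExact) {T : Type*}
    (s : Finset T) (d : T → (X.X₂ ⟶ X.X₂)) (π : T → (B ⟶ X.X₂))
    (hπ : ∀ t ∈ s, X.g ≫ m ≫ π t = d t) {i j : ℕ} (hij : i + 1 = j)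
    (hB : ∀ z : groupCohomology B j, (∀ t ∈ s, (map (MonoidHom.id Γ) (π t) j).hom z = 0) → z = 0)
    (ξ : groupCohomology X.X₂ j) (hξ : ∀ t ∈ s, (map (MonoidHom.id Γ) (d t) j).hom ξ = 0) :
    ∃ c : groupCohomology C i,
      (map (MonoidHom.id Γ) X.g j).hom ξ = (δ hY i j hij).hom c := by
  have hz : (map (MonoidHom.id Γ) m j).hom ((map (MonoidHom.id Γ) X.g j).hom ξ) = 0 := by
    refine hB _ fun t ht => ?_
    rw [← LinearMap.comp_apply, ← ModuleCat.hom_comp, ← map_id_comp, ← LinearMap.comp_apply,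
      ← ModuleCat.hom_comp, ← map_id_comp, hπ t ht]
    exact hξ t ht
  have hex := (ShortComplex.moduleCat_exact_iff _).1 (mapShortComplex₁_exact hY hij)
  obtain ⟨c, hc⟩ := hex _ hz
  exact ⟨c, hc.symm⟩

/-- **Consequence for an equivariant endomorphism: `Uᵐ` of an invariant class restricts from
`X₁`.**  In the situation of `exists_map_g_eq_δ`, let `F` be an endomorphism of
`0 → X₁ → X₂ → X₃ → 0` and `F'` one of `0 → X₃ → B → C → 0` with the same component on `X₃`,
and suppose `(F'_C)ᵐ` kills `Hⁱ(C)`.  Then for every `ξ ∈ Hʲ(X₂)` killed by all `d_t`,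
`(F₂)ᵐ ξ` lies in the image of `Hʲ(X₁) → Hʲ(X₂)`. [cite: KhareThorne2017, §6.3] -/
theorem pow_map_apply_mem_range_of_forall {X : ShortComplex (Rep k Γ)} (hX : X.ShortExact)
    {B C : Rep k Γ} (m : X.X₃ ⟶ B) (q : B ⟶ C) (w : m ≫ q = 0)
    (hY : (ShortComplex.mk m q w).ShortExact) {T : Type*} (s : Finset T)
    (d : T → (X.X₂ ⟶ X.X₂)) (π : T → (B ⟶ X.X₂)) (hπ : ∀ t ∈ s, X.g ≫ m ≫ π t = d t)
    {i j : ℕ} (hij : i + 1 = j)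
    (hB : ∀ z : groupCohomology B j, (∀ t ∈ s, (map (MonoidHom.id Γ) (π t) j).hom z = 0) → z = 0)
    (F : X ⟶ X) (F' : ShortComplex.mk m q w ⟶ ShortComplex.mk m q w) (hFF' : F'.τ₁ = F.τ₃)
    {n : ℕ} (hC : ∀ c : groupCohomology C i, ((map (MonoidHom.id Γ) F'.τ₃ i).hom ^ n) c = 0)
    (ξ : groupCohomology X.X₂ j) (hξ : ∀ t ∈ s, (map (MonoidHom.id Γ) (d t) j).hom ξ = 0) :
    ((map (MonoidHom.id Γ) F.τ₂ j).hom ^ n) ξ ∈ LinearMap.range (map (MonoidHom.id Γ) X.f j).hom := by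
  obtain ⟨c, hc⟩ := exists_map_g_eq_δ m q w hY s d π hπ hij hB ξ hξ
  -- `g_* ((F₂)ⁿ ξ) = (F₃)ⁿ (g_* ξ) = (F₃)ⁿ (∂' c) = ∂' ((F'_C)ⁿ c) = 0`
  have hg : ∀ z, (map (MonoidHom.id Γ) F.τ₃ j).hom ((map (MonoidHom.id Γ) X.g j).hom z) =
      (map (MonoidHom.id Γ) X.g j).hom ((map (MonoidHom.id Γ) F.τ₂ j).hom z) := fun z => by
    rw [← LinearMap.comp_apply, ← ModuleCat.hom_comp, ← map_id_comp, ← LinearMap.comp_apply,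
      ← ModuleCat.hom_comp, ← map_id_comp, F.comm₂₃]
  have hδ : ∀ z, (map (MonoidHom.id Γ) F.τ₃ j).hom ((δ hY i j hij).hom z) =
      (δ hY i j hij).hom ((map (MonoidHom.id Γ) F'.τ₃ i).hom z) := fun z => by
    have h := δ_naturality hY hY F' i j hij
    have h' := congrArg (fun φ => (ModuleCat.Hom.hom φ) z) h
    simp only [ModuleCat.hom_comp, LinearMap.comp_apply] at h'
    rw [hFF'] at h'
    exact h'
  have hzero : (map (MonoidHom.id Γ) X.g j).hom (((map (MonoidHom.id Γ) F.τ₂ j).hom ^ n) ξ) = 0 := by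
    rw [← pow_apply_comp_eq _ _ _ hg n ξ, hc, pow_apply_comp_eq _ _ _ hδ n c, hC c, map_zero]
  have hex := (ShortComplex.moduleCat_exact_iff _).1 (mapShortComplex₂_exact hX j)
  obtain ⟨y, hy⟩ := hex _ hzero
  exact ⟨y, hy⟩

/-! ### Top degree: surjectivity of `Hʲ(X₂) → Hʲ(X₃)` and its kernel -/

/-- **`Hʲ(X₂) → Hʲ(X₃)` is surjective when `Hʲ⁺¹(X₁) = 0`** (long exact sequence; the
surjectivity of the transfer `Nm_* : H²(A) → H²(A^Δ̄)` in the top degree).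
[cite: Brown1982CohomologyGroups, III.6 Prop. 6.1] -/
theorem map_g_surjective_of_subsingleton {Z : ShortComplex (Rep k Γ)} (hZ : Z.ShortExact) (j : ℕ)
    [h : Subsingleton (groupCohomology Z.X₁ (j + 1))] :
    Function.Surjective (map (MonoidHom.id Γ) Z.g j).hom := by
  intro x
  have hex := (ShortComplex.moduleCat_exact_iff _).1 (mapShortComplex₃_exact hZ (rfl : j + 1 = j + 1))
  exact hex x (@Subsingleton.elim (groupCohomology Z.X₁ (j + 1)) h _ _)

/-- **The kernel of `Hʲ(X₂) → Hʲ(X₃)` is `∑_t e_t Hʲ(X₂)`** under the top-degree hypotheses: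
`0 → X₁ →f→ X₂ →g→ X₃ → 0` and `0 → K' →κ→ B' →σ→ X₁ → 0` short exact, `Hʲ⁺¹(K') = 0`,
morphisms `ι_t : X₂ → B'` whose images generate `Hʲ(B')`, and `ι_t ≫ σ ≫ f = e_t`.  Then every
`x ∈ ker(g_*)` is `f_* y` with `y = σ_* z` (surjectivity of `σ_*`), `z = ∑ ι_{t*} a_t`, so
`x = ∑ e_{t*} a_t` (for `X₁ = I_Δ̄ A = ∑ (δ_t − 1) A`, `B' = ⊕_t A`: `ker(tr) = I_Δ̄ · H²(A)`).
[cite: KhareThorne2017, §6.3] -/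
theorem exists_eq_sum_map_of_map_g_eq_zero {Z : ShortComplex (Rep k Γ)} (hZ : Z.ShortExact)
    {K' B' : Rep k Γ} (κ : K' ⟶ B') (σ : B' ⟶ Z.X₁) (w : κ ≫ σ = 0)
    (hW : (ShortComplex.mk κ σ w).ShortExact) {T : Type*} (s : Finset T)
    (ι : T → (Z.X₂ ⟶ B')) (e : T → (Z.X₂ ⟶ Z.X₂)) (he : ∀ t ∈ s, ι t ≫ σ ≫ Z.f = e t) (j : ℕ)
    [hK : Subsingleton (groupCohomology K' (j + 1))]
    (hgen : ∀ z : groupCohomology B' j, ∃ a : T → groupCohomology Z.X₂ j,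
      z = ∑ t ∈ s, (map (MonoidHom.id Γ) (ι t) j).hom (a t))
    (x : groupCohomology Z.X₂ j) (hx : (map (MonoidHom.id Γ) Z.g j).hom x = 0) :
    ∃ a : T → groupCohomology Z.X₂ j, x = ∑ t ∈ s, (map (MonoidHom.id Γ) (e t) j).hom (a t) := by
  have hex := (ShortComplex.moduleCat_exact_iff _).1 (mapShortComplex₂_exact hZ j)
  obtain ⟨y, hy⟩ := hex x hx
  obtain ⟨z, hz⟩ := map_g_surjective_of_subsingleton hW j y
  obtain ⟨a, ha⟩ := hgen z
  refine ⟨a, ?_⟩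
  have hy' : (map (MonoidHom.id Γ) Z.f j).hom y = x := hy
  have hz' : (map (MonoidHom.id Γ) σ j).hom z = y := hz
  rw [← hy', ← hz', ha, map_sum, map_sum]
  refine Finset.sum_congr rfl fun t ht => ?_
  rw [← he t ht, map_id_comp, map_id_comp, ModuleCat.hom_comp, ModuleCat.hom_comp,
    LinearMap.comp_apply, LinearMap.comp_apply]

/-- The converse inclusion: `∑_t e_t Hʲ(X₂) ≤ ker(g_*)` as soon as `e_t ≫ g = 0`. [folklore] -/
theorem map_g_sum_map_eq_zero {Z : ShortComplex (Rep k Γ)} {T : Type*} (s : Finset T)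
    (e : T → (Z.X₂ ⟶ Z.X₂)) (he : ∀ t ∈ s, e t ≫ Z.g = 0) (j : ℕ)
    (a : T → groupCohomology Z.X₂ j) :
    (map (MonoidHom.id Γ) Z.g j).hom (∑ t ∈ s, (map (MonoidHom.id Γ) (e t) j).hom (a t)) = 0 := by
  rw [map_sum]
  refine Finset.sum_eq_zero fun t ht => ?_
  rw [← LinearMap.comp_apply, ← ModuleCat.hom_comp, ← map_id_comp, he t ht,
    ArithmeticQuotient.map_id_zero]
  rfl

/-! ### Joint injectivity / generation from a biproduct-type decomposition -/

/-- **Joint injectivity of the projections on cohomology** from `∑_t π_t ≫ ι_t = 𝟙 B`: if all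
`π_{t*} z = 0` then `z = ∑ ι_{t*} π_{t*} z = 0`. [folklore] -/
theorem eq_zero_of_forall_map_proj_eq_zero {A B : Rep k Γ} {T : Type*} (s : Finset T)
    (π : T → (B ⟶ A)) (ι : T → (A ⟶ B)) (htot : ∑ t ∈ s, π t ≫ ι t = 𝟙 B) (j : ℕ)
    (z : groupCohomology B j) (hz : ∀ t ∈ s, (map (MonoidHom.id Γ) (π t) j).hom z = 0) : z = 0 := by
  have h : (map (MonoidHom.id Γ) (∑ t ∈ s, π t ≫ ι t) j).hom z = z := by
    rw [htot, map_id]; rfl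
  rw [← h, ArithmeticQuotient.map_id_sum, ModuleCat.hom_sum, LinearMap.sum_apply]
  refine Finset.sum_eq_zero fun t ht => ?_
  rw [map_id_comp, ModuleCat.hom_comp, LinearMap.comp_apply, hz t ht, map_zero]

/-- **Generation of the cohomology of `B` by the inclusions** from `∑_t π_t ≫ ι_t = 𝟙 B`:
`z = ∑ ι_{t*} (π_{t*} z)`. [folklore] -/
theorem exists_eq_sum_map_incl {A B : Rep k Γ} {T : Type*} (s : Finset T)
    (π : T → (B ⟶ A)) (ι : T → (A ⟶ B)) (htot : ∑ t ∈ s, π t ≫ ι t = 𝟙 B) (j : ℕ)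
    (z : groupCohomology B j) :
    ∃ a : T → groupCohomology A j, z = ∑ t ∈ s, (map (MonoidHom.id Γ) (ι t) j).hom (a t) := by
  refine ⟨fun t => (map (MonoidHom.id Γ) (π t) j).hom z, ?_⟩
  have h : (map (MonoidHom.id Γ) (∑ t ∈ s, π t ≫ ι t) j).hom z = z := by
    rw [htot, map_id]; rfl
  conv_lhs => rw [← h]
  rw [ArithmeticQuotient.map_id_sum, ModuleCat.hom_sum, LinearMap.sum_apply]
  refine Finset.sum_congr rfl fun t _ => ?_
  rw [map_id_comp, ModuleCat.hom_comp, LinearMap.comp_apply]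

end LevelControl

end Literature.NumberTheory.Automorphic
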